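import Mathlib
import Literature.Combinatorics.Optimization.ThreeSatThreeXorSosGaps
import Literature.Combinatorics.Optimization.MaxThreeSatSdpLowerBound
import Literature.Combinatorics.Optimization.PsdRankLowerBoundsUnconditional

/-!
# Schoenebeck 2008 for Max-`k`-SAT, all `k ≥ 3`: linear-degree sum-of-squares does not beat
# `1 − 2^{−k}`, and polynomial-size SDP relaxations do not either (LRS Thm 1.6) — PROVED

Schoenebeck (FOCS 2008) proved that `Ω(n)` levels of the Lasserre / sum-of-squares hierarchy
cannot refute a random `k`-CNF (`k ≥ 3`) and, as a corollary, that the Max-`k`-SAT integrality gap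
stays `2^k/(2^k − 1) − ε` after `Ω(n)` rounds (restated by Tulsiani, STOC 2009, p. 2 of the
introduction: "Schoenebeck [25] recently showed a gap of factor 2 for MAX k-XOR for `Ω(n)` [rounds]
and also strengthened the MAX k-SAT results [`2^k/(2^k−1)`, Alekhnovich–Arora–Tourlakis] for `Ω(n)`
rounds of Lasserre").  The `k = 3` case (Grigoriev 2001 / Schoenebeck 2008, Fleming–Kothari–Pitassi
2019 Thm 5.2) is `Schoenebeck2008_maxThreeSatSos_holds` of `ThreeSatThreeXorSosGaps.lean`.

This file proves the general-`k` statement in the tree's Max-CSP currency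
(`Schoenebeck2008_maxKSatSos`): for every `k ≥ 3` and `ε > 0` there are `c_ε > 0`, `n₀` with, for
all `n ≥ n₀`, a Max-`k`-SAT instance `ℑ` on `n` variables (`CSPInstance k n (maxKSatPreds k)`) of
optimum `≤ 1 − 2^{−k} + ε` such that no `c < 1` admits a degree-`⌊c_ε n⌋` sum-of-squares
certificate of `c − ℑ` on the cube — by exactly the route of the `k = 3` file:

1. `exists_good_tupleK`: for `Δ = ⌈2^{k+1}/ε²⌉` and all large `n` some tuple of `Δ n` clauses of
   `kClauses k n` is a `(⌊κn⌋, (2k+1)/4)`-cover expander (the tree's first-moment count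
   `card_le_of_forall_not_isCoverExpander_linear`, stated there for all `k ≥ 3`) and has every
   assignment satisfying `≤ (1 − 2^{−k} + ε) Δ n` clauses (the exponential-moment count
   `card_filter_exists_manyGood_le` of `RandomThreeCnfValueCount.lean` with the marginal
   `card_filter_satGoodK_le`, itself the tree's `card_filter_eval_le`).
2. cover expansion `(2k+1)/4 = (k + 1/2)/2` ⇒ boundary expansion `1/2`
   (`IsCoverExpander.isBoundaryExpander`) ⇒ `(⌊κn⌋, 1/2)`-vector expansion ⇒ the
   Grigoriev–Schoenebeck pseudo-density of degree `d = ⌊κ n/32⌋ ≥ k`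
   (`isPseudoDensity_gsDensity`) gives every clause of the tuple pseudo-probability `1`
   (`cubeExpect_gsDensity_mul_unsatInd`, valid for clauses of any length `≤ d`), and weak duality
   (`IsPseudoDensity.cubeExpect_mul_nonneg`) excludes certificates of `c − ℑ`, `c < 1`.

Consequences recorded: `maxKSatPreds 3 = maxThreeSatPreds` (`rfl`); the degree-`d` relaxation
fails to `(c, 1 − 2^{−k} + ε)`-approximate Max-`k`-SAT (`Schoenebeck2008_maxKSatSos_not_achievesApprox`);
and, with the tree's PROVED Lee–Raghavendra–Steurer Thm 1.6 (`LeeRaghavendraSteurer2015_thm16_holds`),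
**polynomial-size SDP relaxations cannot achieve a `(c, s)`-approximation of Max-`k`-SAT for any
`s > 1 − 2^{−k}`, `c < 1`** (`LeeRaghavendraSteurer2015_maxKSat_poly`, an instance of the
general-`𝒫` transfer `LeeRaghavendraSteurer2015_poly_of_linearSosGap`) — the Max-CSP form of
LRS's headline claim for every `k ≥ 3`, unconditional (for `k = 3` it is, after
`rw [maxKSatPreds_three]`, the landed `LeeRaghavendraSteurer2015_maxThreeSat_poly`).
Finally the printed proof of LRS Thm 1.5 is run for an ARBITRARY predicate set
(`LeeRaghavendraSteurer2015_quasipoly_of_linearSosGap`: a linear-degree sum-of-squares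
`(c, s₀ + ε)`-gap for Max-`𝒫` gives, via the tree's PROVED corrected Thm 6.4
`LeeRaghavendraSteurer2015_thm64_repaired_holds`, that no SDP relaxation of size
`n^{α log n / log log n}` achieves a `(c,s)`-approximation, `s₀ < s < c < 1`), whence
`LeeRaghavendraSteurer2015_maxKSat_quasipoly` (Thm 1.5 for Max-`k`-SAT, every `k ≥ 3`).

No definitions of facts (D-0026): every statement here is a theorem.

## References

* G. Schoenebeck, *Linear Level Lasserre Lower Bounds for Certain k-CSPs*, FOCS 2008, 593–602,
  doi:10.1109/FOCS.2008.74 [Schoenebeck2008] (the random-`k`-CNF theorem and its Max-`k`-SAT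
  corollary).
* M. Tulsiani, *CSP gaps and reductions in the Lasserre hierarchy*, STOC 2009, 303–312
  [Tulsiani2009], §1 (p. 2: restatement of Schoenebeck's Max-`k`-SAT bound) and Thm 4.2
  (generalisation of Schoenebeck's theorem); held text `paper:galaxy-pdf-8496938138076993900`.
* N. Fleming, P. Kothari, T. Pitassi, Found. Trends TCS 14 (2019), §5.1 (the `k = 3` write-up
  followed by the `k = 3` files) [FlemingKothariPitassi2019].
* J. R. Lee, P. Raghavendra, D. Steurer, *Lower bounds on the size of semidefinite programming
  relaxations*, STOC 2015, Thm 1.6 and p. 6 [LeeRaghavendraSteurer2015].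
-/

noncomputable section

open Finset Filter
open Literature.Probability.RandomGraphs.LowDegree (walsh sgn)
open Literature.Computability.Complexity (Literal Clause kClauses clauseOf)
open Literature.Computability.MetaComplexity (ParityVec indVec clauseScope clauseVec clauseSign
  litVec IsCoverExpander VecExpands clauseVec_eq_indVec vecExpands_of_isBoundaryExpander
  nodup_map_fst_of_mem_kClauses card_clauseScope_of_mem_kClauses card_kClauses clauseSign_mul_self
  indVec_eq_sum card_le_of_forall_not_isCoverExpander_linear card_filter_eval_le)

namespace Literature.Combinatorics.Optimization

variable {k n m : ℕ}

/-! ### `k`-clauses: literals, variables, scopes -/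

/-- The `j`-th literal (`j < k`) of a `k`-clause. [cite: Schoenebeck2008, §2 (random `k`-CNF)] -/
def litK (C : ↥(kClauses k n)) (j : Fin k) : Literal ℕ :=
  C.1[j.1]'(by rw [length_of_mem_kClauses C.2]; exact j.2)

/-- `litK C j` is a literal of `C`. [cite: Schoenebeck2008, §2] -/
theorem litK_mem (C : ↥(kClauses k n)) (j : Fin k) : litK C j ∈ C.1 :=
  List.getElem_mem _

/-- The variable of the `j`-th literal, in `Fin n`. [cite: Schoenebeck2008, §2] -/
def varK (C : ↥(kClauses k n)) (j : Fin k) : Fin n :=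
  ⟨(litK C j).1, fst_lt_of_mem_kClauses C.2 _ (litK_mem C j)⟩

/-- The `k` variables of a `k`-clause are distinct. [cite: Schoenebeck2008, §2] -/
theorem varK_injective (C : ↥(kClauses k n)) : Function.Injective (varK C) := by
  intro j₁ j₂ h
  have hnd := nodup_map_fst_of_mem_kClauses C.2
  have hlen := length_of_mem_kClauses C.2
  have h' : (litK C j₁).1 = (litK C j₂).1 := by
    have := congrArg Fin.val h
    simpa [varK] using this
  have e1 : (C.1.map Prod.fst)[j₁.1]'(by simp [hlen]) = (litK C j₁).1 := List.getElem_map ..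
  have e2 : (C.1.map Prod.fst)[j₂.1]'(by simp [hlen]) = (litK C j₂).1 := List.getElem_map ..
  exact Fin.ext ((hnd.getElem_inj_iff).1 (e1.trans (h'.trans e2.symm)))

/-- The index embedding `Fin k ↪ Fin n` of a `k`-clause. [cite: Schoenebeck2008, §2] -/
def idxK (C : ↥(kClauses k n)) : Fin k ↪ Fin n := ⟨varK C, varK_injective C⟩

/-- The scope of a `k`-clause as a `k`-subset of `Fin n`. [cite: Schoenebeck2008, §2] -/
def scopeK (C : ↥(kClauses k n)) : Finset (Fin n) := univ.image (varK C)

/-- `|scopeK C| = k`. [cite: Schoenebeck2008, §2] -/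
theorem card_scopeK (C : ↥(kClauses k n)) : (scopeK C).card = k := by
  rw [scopeK, card_image_of_injective _ (varK_injective C), card_univ, Fintype.card_fin]

/-- Every literal of a `k`-clause is some `litK C j`. [cite: Schoenebeck2008, §2] -/
theorem exists_eq_litK (C : ↥(kClauses k n)) {l : Literal ℕ} (hl : l ∈ C.1) :
    ∃ j, litK C j = l := by
  obtain ⟨i, hi, rfl⟩ := List.mem_iff_getElem.1 hl
  have hlen := length_of_mem_kClauses C.2
  exact ⟨⟨i, by omega⟩, rfl⟩

/-- The scope vector of a `k`-clause is the parity vector of `scopeK`. [cite: Schoenebeck2008, §3] -/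
theorem toVec_scopeK (C : ↥(kClauses k n)) : toVec (scopeK C) = clauseVec C.1 := by
  classical
  have hlen := length_of_mem_kClauses C.2
  rw [toVec, indVec_eq_sum, clauseVec, litVec, scopeK, Finset.map_eq_image, Finset.image_image,
    Finset.sum_image]
  · rw [← Equiv.sum_comp (finCongr hlen.symm)]
    rfl
  · intro j₁ _ j₂ _ h
    exact varK_injective C (Fin.ext (by simpa [varK] using h))

/-! ### Max-`k`-SAT as a Boolean CSP and the instance of a clause tuple -/

/-- Max-`k`-SAT: "`𝒫` contains all `2^k` `k`-literal disjunctions" — the disjunction with sign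
pattern `σ ∈ {0,1}^k` is falsified exactly by the local assignment `σ` (the tree's
`maxThreeSatPreds` for general `k`). [cite: LeeRaghavendraSteurer2015, §1.2 (p. 6)] -/
def maxKSatPreds (k : ℕ) : Set ((Fin k → Bool) → Bool) :=
  Set.range fun σ : Fin k → Bool => fun y => decide (y ≠ σ)

/-- `maxKSatPreds 3` is the tree's `maxThreeSatPreds`. [cite: LeeRaghavendraSteurer2015, §1.2 (p. 6)] -/
theorem maxKSatPreds_three : maxKSatPreds 3 = maxThreeSatPreds := rfl

/-- The falsifying pattern of a `k`-clause: the literal `(v, β)` is false iff `x_v = ¬β`.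
[cite: Schoenebeck2008, §2] -/
def falsePatternK (C : ↥(kClauses k n)) : Fin k → Bool := fun j => !(litK C j).2

/-- The Max-`k`-SAT constraint of a `k`-clause. [cite: Schoenebeck2008, §2] -/
def satConstraintK (C : ↥(kClauses k n)) : CSPConstraint k n (maxKSatPreds k) :=
  ⟨fun y => decide (y ≠ falsePatternK C), ⟨falsePatternK C, rfl⟩, idxK C⟩

/-- **The constraint is the clause:** for any assignment `σ` extending `x` on `[n]`,
`(satConstraintK C).sat x = Clause.eval σ C`. [cite: Schoenebeck2008, §2] -/
theorem satConstraintK_sat (C : ↥(kClauses k n)) (x : Fin n → Bool) (σ : ℕ → Bool)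
    (hσ : ∀ (v : ℕ) (h : v < n), σ v = x ⟨v, h⟩) :
    (satConstraintK C).sat x = Literature.Computability.Complexity.Clause.eval σ C.1 := by
  have key : (satConstraintK C).sat x = true ↔
      Literature.Computability.Complexity.Clause.eval σ C.1 = true := by
    rw [Literature.Computability.Complexity.Clause.eval, List.any_eq_true]
    simp only [satConstraintK, CSPConstraint.sat, decide_eq_true_eq]
    have hlit : ∀ j : Fin k, Literature.Computability.Complexity.Literal.eval σ (litK C j) = true ↔
        x (varK C j) = (litK C j).2 := by
      intro j
      rw [Literature.Computability.Complexity.Literal.eval, beq_iff_eq,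
        hσ (litK C j).1 (varK C j).2]
      rfl
    constructor
    · intro h
      obtain ⟨j, hj⟩ : ∃ j, x (idxK C j) ≠ falsePatternK C j := by
        by_contra hall
        push Not at hall
        exact h (funext hall)
      refine ⟨litK C j, litK_mem C j, (hlit j).2 ?_⟩
      have hj' : x (varK C j) ≠ !(litK C j).2 := hj
      revert hj'
      cases x (varK C j) <;> cases (litK C j).2 <;> simp
    · rintro ⟨l, hl, hlt⟩ heq
      obtain ⟨j, rfl⟩ := exists_eq_litK C hl
      have h1 : x (varK C j) = !(litK C j).2 := congrFun heq j
      have h2 : x (varK C j) = (litK C j).2 := (hlit j).1 hlt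
      rw [h2] at h1
      revert h1
      cases (litK C j).2 <;> simp
  rcases Bool.eq_false_or_eq_true ((satConstraintK C).sat x) with h | h <;>
    rcases Bool.eq_false_or_eq_true (Literature.Computability.Complexity.Clause.eval σ C.1)
      with h' | h' <;> simp_all

/-- **The Max-`k`-SAT instance of a clause tuple** `ω : Fin m → kClauses k n` (`m ≥ 1`).
[cite: Schoenebeck2008, §2 (random `k`-CNF with `Δ n` clauses)] -/
def satInstanceK (ω : Fin m → ↥(kClauses k n)) (hm : 0 < m) : CSPInstance k n (maxKSatPreds k) :=
  ⟨m, hm, fun i => satConstraintK (ω i)⟩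

/-- The value of the instance at `x` is the fraction of clauses satisfied by any extension of `x`.
[cite: Schoenebeck2008, §2] -/
theorem satInstanceK_val (ω : Fin m → ↥(kClauses k n)) (hm : 0 < m) (x : Fin n → Bool)
    (σ : ℕ → Bool) (hσ : ∀ (v : ℕ) (h : v < n), σ v = x ⟨v, h⟩) :
    (satInstanceK ω hm).val x =
      ((univ.filter fun i : Fin m =>
        Literature.Computability.Complexity.Clause.eval σ (ω i).1 = true).card : ℝ) / m := by
  unfold CSPInstance.val satInstanceK
  simp only
  congr 1
  rw [← Finset.sum_boole]
  refine Finset.sum_congr rfl fun i _ => ?_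
  rw [satConstraintK_sat (ω i) x σ hσ]

/-! ### The marginal: a fixed assignment satisfies at most `1 − 2^{−k}` of the `k`-clauses -/

/-- A subtype filter is bounded by the corresponding filter of the underlying finset. [folklore] -/
private theorem card_filter_univ_subtype_le' {α : Type*} [DecidableEq α] (s : Finset α)
    (P : α → Prop) [DecidablePred P] :
    ((univ : Finset ↥s).filter fun x => P x.1).card ≤ (s.filter P).card := by
  refine Finset.card_le_card_of_injOn (fun x => x.1) (fun x hx => ?_) (fun x _ y _ h => Subtype.ext h)
  simp only [Finset.coe_filter, Finset.mem_univ, true_and, Set.mem_setOf_eq] at hx ⊢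
  exact ⟨x.2, hx⟩

/-- **At most `1 − 2^{−k}` of the `k`-clauses are true under a fixed assignment** (for each scope
exactly one of the `2^k` sign patterns is falsified; the tree's `card_filter_eval_le`).
[cite: Schoenebeck2008, §2 (a random clause is satisfied with probability `1 − 2^{−k}`)] -/
theorem card_filter_satGoodK_le (k n : ℕ) (σ : ℕ → Bool) :
    (((univ : Finset ↥(kClauses k n)).filter fun C =>
        Literature.Computability.Complexity.Clause.eval σ C.1 = true).card : ℝ) ≤
      (1 - 1 / 2 ^ k : ℝ) * Fintype.card ↥(kClauses k n) := by
  have h1 := card_filter_univ_subtype_le' (kClauses k n)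
    (fun C => Literature.Computability.Complexity.Clause.eval σ C = true)
  have h2 := card_filter_eval_le k n σ
  have h3 : Fintype.card ↥(kClauses k n) = n.choose k * 2 ^ k := by
    rw [Fintype.card_coe, card_kClauses]
  rw [h3]
  have h4 : (((univ : Finset ↥(kClauses k n)).filter fun C =>
      Literature.Computability.Complexity.Clause.eval σ C.1 = true).card : ℝ) ≤
      (n.choose k : ℝ) * (2 ^ k - 1) := by
    have h12 := h1.trans h2
    have hcast : ((n.choose k * (2 ^ k - 1) : ℕ) : ℝ) = (n.choose k : ℝ) * (2 ^ k - 1) := by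
      rw [Nat.cast_mul, Nat.cast_sub Nat.one_le_two_pow]; push_cast; ring
    rw [← hcast]
    exact_mod_cast h12
  have h2k : (0 : ℝ) < 2 ^ k := by positivity
  calc _ ≤ (n.choose k : ℝ) * (2 ^ k - 1) := h4
    _ = (1 - 1 / 2 ^ k : ℝ) * ((n.choose k * 2 ^ k : ℕ) : ℝ) := by
        push_cast; field_simp

/-! ### The Grigoriev–Schoenebeck family of a `k`-clause tuple -/

/-- The scope vectors of a `k`-clause tuple. [cite: Schoenebeck2008, §3] -/
def tupleVecsK (ω : Fin m → ↥(kClauses k n)) : Fin m → ParityVec := fun i => clauseVec (ω i).1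

/-- The parity signs `−∏_j s_j` of the clauses. [cite: Schoenebeck2008, §5 (from `k`-XOR to `k`-SAT)] -/
def tupleSatSignsK (ω : Fin m → ↥(kClauses k n)) : Fin m → ℝ := fun i => clauseSign (ω i).1

/-- **Cover expansion `(2k+1)/4` of the scopes gives `(N, 1/2)`-vector expansion of the scope
vectors** (`|∂F| ≥ 2·((2k+1)/4)|F| − k|F| = |F|/2`). [cite: Schoenebeck2008, §3 (expansion ⇒ no
low-width parity refutation)] -/
theorem vecExpands_tupleVecsK (ω : Fin m → ↥(kClauses k n)) {N : ℝ}
    (hexp : IsCoverExpander (fun i => clauseScope (ω i).1) N ((2 * k + 1) / 4)) :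
    VecExpands (tupleVecsK ω) N (1 / 2) := by
  classical
  have hk : ∀ i, (clauseScope (ω i).1).card ≤ k := fun i =>
    (card_clauseScope_of_mem_kClauses (ω i).2).le
  have hexp' : IsCoverExpander (fun i => clauseScope (ω i).1) N (((k : ℕ) + (1 / 2 : ℝ)) / 2) := by
    convert hexp using 1; ring
  have hB := Literature.Computability.MetaComplexity.IsCoverExpander.isBoundaryExpander hk hexp'
  have hV := vecExpands_of_isBoundaryExpander hB
  have hfun : tupleVecsK ω = fun i => indVec (clauseScope (ω i).1) := by
    funext i
    exact clauseVec_eq_indVec (nodup_map_fst_of_mem_kClauses (ω i).2)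
  rw [hfun]
  exact hV

/-! ### Good `k`-clause tuples exist (expansion and value, by counting) -/

/-- **Good tuples exist.** For `k ≥ 3` and `0 < ε ≤ 1` there are `Δ ≥ 1`, `κ > 0` and `n₀` such
that for every `n ≥ n₀` some tuple `ω` of `Δ n` clauses from `kClauses k n` has
`(⌊κn⌋, (2k+1)/4)`-cover expanding scopes and every assignment satisfying at most
`(1 − 2^{−k} + ε) Δn` of its clauses — the two failure counts
(`card_le_of_forall_not_isCoverExpander_linear`; `card_filter_exists_manyGood_le` with
`p = 1 − 2^{−k}`, `Δ = ⌈2^{k+1}/ε²⌉`) add up to less than the number of tuples.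
[cite: Schoenebeck2008, §2–3 (a random `k`-CNF of density `Δ` is expanding and has value
`≤ 1 − 2^{−k} + ε` w.h.p.)] -/
theorem exists_good_tupleK (hk : 3 ≤ k) {ε : ℝ} (hε0 : 0 < ε) (hε1 : ε ≤ 1) :
    ∃ Δ : ℕ, 1 ≤ Δ ∧ ∃ κ : ℝ, 0 < κ ∧ ∃ n₀ : ℕ, ∀ n : ℕ, n₀ ≤ n →
      ∃ ω : Fin (Δ * n) → ↥(kClauses k n),
        IsCoverExpander (fun i => clauseScope (ω i).1) (⌊κ * n⌋₊ : ℕ) ((2 * k + 1) / 4) ∧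
        (∀ x : Fin n → Bool, ((univ.filter fun i : Fin (Δ * n) =>
            Literature.Computability.Complexity.Clause.eval (extAssign x) (ω i).1 = true).card : ℝ) ≤
          (1 - 1 / 2 ^ k + ε) * (Δ * n : ℕ)) := by
  classical
  -- constants
  have h2k : (0 : ℝ) < 2 ^ k := by positivity
  set Δ : ℕ := ⌈2 ^ (k + 1) / ε ^ 2⌉₊ with hΔdef
  have hΔge : (2 : ℝ) ^ (k + 1) / ε ^ 2 ≤ (Δ : ℝ) := Nat.le_ceil _
  have hε2 : 0 < ε ^ 2 := by positivity
  have hΔ1 : 1 ≤ Δ := by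
    have h2k1 : (1 : ℝ) ≤ 2 ^ (k + 1) := one_le_pow₀ (by norm_num)
    have : (1 : ℝ) ≤ 2 ^ (k + 1) / ε ^ 2 := by
      rw [le_div_iff₀ hε2]; nlinarith
    have h : (1 : ℝ) ≤ Δ := by linarith
    exact_mod_cast h
  set a : ℝ := (2 * k + 1) / 4 with ha
  have hapos : 0 < a := by rw [ha]; positivity
  set B : ℝ := Real.exp (1 + a) * Δ * a with hB
  have hBpos : 0 < B := by rw [hB]; positivity
  set κ : ℝ := 1 / (a * (2 * B) ^ 4) with hκ
  have hκpos : 0 < κ := by rw [hκ]; positivity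
  refine ⟨Δ, hΔ1, κ, hκpos, max k ⌈128 * a * B ^ 4⌉₊, fun n hn => ?_⟩
  have hkn : k ≤ n := le_of_max_le_left hn
  have hn1 : 1 ≤ n := by omega
  have hnr : (0 : ℝ) < n := by exact_mod_cast hn1
  have hnB : 128 * a * B ^ 4 ≤ n := (Nat.le_ceil _).trans (by exact_mod_cast le_of_max_le_right hn)
  -- the clause space
  have hKc : (kClauses k n).card = n.choose k * 2 ^ k := card_kClauses k n
  have hK : (kClauses k n).Nonempty := by
    rw [← Finset.card_pos, hKc]
    exact Nat.mul_pos (Nat.choose_pos hkn) (by positivity)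
  set X := ↥(kClauses k n)
  set m := Δ * n with hm
  have hcardX : (Fintype.card X : ℝ) = (kClauses k n).card := by rw [Fintype.card_coe]
  set T : ℝ := ((kClauses k n).card : ℝ) ^ m with hT
  have hTpos : 0 < T := by rw [hT]; exact pow_pos (by exact_mod_cast Finset.card_pos.2 hK) _
  -- the two bad sets
  set badExp : Finset (Fin m → X) := univ.filter fun ω =>
    ¬ IsCoverExpander (fun i => clauseScope (ω i).1) (⌊κ * n⌋₊ : ℕ) ((2 * k + 1) / 4) with hbadExp
  set badSat : Finset (Fin m → X) := univ.filter fun ω => ∃ σ : Fin n → Bool,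
    (1 - 1 / 2 ^ k + ε) * m < ((univ.filter fun i =>
      Literature.Computability.Complexity.Clause.eval (extAssign σ) (ω i).1 = true).card : ℝ)
    with hbadSat
  -- (1) expansion failures
  have h1 : (badExp.card : ℝ) ≤ T / 4 := by
    have hN : a * (⌊κ * n⌋₊ : ℕ) ≤ n / (2 * B) ^ 4 := by
      have hf : ((⌊κ * n⌋₊ : ℕ) : ℝ) ≤ κ * n := Nat.floor_le (by positivity)
      have : a * (κ * n) = n / (2 * B) ^ 4 := by
        rw [hκ]; field_simp
      calc a * (⌊κ * n⌋₊ : ℕ) ≤ a * (κ * n) := by gcongr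
        _ = n / (2 * B) ^ 4 := this
    have h := card_le_of_forall_not_isCoverExpander_linear (k := k) (Δ := Δ) (n := n)
      (N := ⌊κ * n⌋₊) (a := a) (B := B) hk hΔ1 hn1 hK ha hB hN badExp
      (fun c hc => (Finset.mem_filter.1 hc).2)
    have hcoef : 32 * a * B ^ 4 / n ≤ 1 / 4 := by
      rw [div_le_iff₀ hnr]
      calc (32 : ℝ) * a * B ^ 4 = 1 / 4 * (128 * a * B ^ 4) := by ring
        _ ≤ 1 / 4 * (n : ℝ) := by gcongr
    calc (badExp.card : ℝ) ≤ 32 * a * B ^ 4 / n * ((((kClauses k n).card ^ (Δ * n) : ℕ)) : ℝ) := h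
      _ ≤ 1 / 4 * T := by
          rw [hT, hm]; push_cast
          exact mul_le_mul_of_nonneg_right hcoef (by positivity)
      _ = T / 4 := by ring
  -- (2) value failures
  have h2 : (badSat.card : ℝ) ≤ 2 / 7 * T := by
    have hp0 : (0 : ℝ) ≤ 1 - 1 / 2 ^ k := by
      rw [sub_nonneg, div_le_one h2k]; exact one_le_pow₀ (by norm_num)
    have h := card_filter_exists_manyGood_le (n := n) (X := X)
      (fun σ C => Literature.Computability.Complexity.Clause.eval (extAssign σ) C.1 = true)
      (p := 1 - 1 / 2 ^ k) (ε := ε) hp0 (fun σ => card_filter_satGoodK_le k n (extAssign σ))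
      hε0.le hε1 m
    rw [hcardX] at h
    have hq : (2 : ℝ) ≤ (1 - (1 - 1 / 2 ^ k)) * ε ^ 2 * Δ := by
      have h22 : (2 : ℝ) ^ (k + 1) = 2 * 2 ^ k := by ring
      have : (2 : ℝ) ^ (k + 1) ≤ ε ^ 2 * Δ := by
        calc (2 : ℝ) ^ (k + 1) = ε ^ 2 * (2 ^ (k + 1) / ε ^ 2) := by field_simp
          _ ≤ ε ^ 2 * Δ := by gcongr
      rw [show (1 - (1 - 1 / 2 ^ k)) * ε ^ 2 * (Δ : ℝ) = (ε ^ 2 * Δ) / 2 ^ k by ring,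
        le_div_iff₀ h2k]
      linarith
    have h2n := two_pow_mul_exp_neg_two_mul_le hn1
    have hexple : Real.exp (-((1 - (1 - 1 / 2 ^ k)) * ε ^ 2 * (m : ℕ))) ≤ Real.exp (-(2 * n)) := by
      rw [Real.exp_le_exp, hm]; push_cast; nlinarith
    have h3 : (2 : ℝ) ^ n * Real.exp (-((1 - (1 - 1 / 2 ^ k)) * ε ^ 2 * (m : ℕ))) ≤ 2 / 7 :=
      le_trans (by gcongr) h2n
    calc (badSat.card : ℝ) ≤ 2 ^ n * (((kClauses k n).card : ℝ) ^ m *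
          Real.exp (-((1 - (1 - 1 / 2 ^ k)) * ε ^ 2 * m))) := h
      _ = 2 ^ n * Real.exp (-((1 - (1 - 1 / 2 ^ k)) * ε ^ 2 * (m : ℕ))) * T := by rw [hT]; ring
      _ ≤ 2 / 7 * T := mul_le_mul_of_nonneg_right h3 hTpos.le
  -- a tuple outside the two bad sets
  have hlt : ((badExp ∪ badSat).card : ℝ) < (univ : Finset (Fin m → X)).card := by
    have hU : ((univ : Finset (Fin m → X)).card : ℝ) = T := by
      rw [Finset.card_univ, Fintype.card_fun, Fintype.card_fin, hT, Nat.cast_pow, hcardX]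
    have hu : ((badExp ∪ badSat).card : ℝ) ≤ badExp.card + badSat.card := by
      exact_mod_cast Finset.card_union_le badExp badSat
    rw [hU]
    linarith
  have hne : ((univ : Finset (Fin m → X)) \ (badExp ∪ badSat)).Nonempty := by
    rw [Finset.nonempty_iff_ne_empty]
    intro h
    have := Finset.card_sdiff_add_card_eq_card (Finset.subset_univ (badExp ∪ badSat))
    rw [h, Finset.card_empty, zero_add] at this
    rw [this] at hlt
    exact lt_irrefl _ hlt
  obtain ⟨ω, hω⟩ := hne
  rw [Finset.mem_sdiff, Finset.mem_union, not_or] at hω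
  obtain ⟨-, hωE, hωS⟩ := hω
  refine ⟨ω, ?_, fun x => ?_⟩
  · by_contra hc
    exact hωE (Finset.mem_filter.2 ⟨Finset.mem_univ _, hc⟩)
  · by_contra hc
    push Not at hc
    exact hωS (Finset.mem_filter.2 ⟨Finset.mem_univ _, x, hc⟩)

/-! ### The pseudo-expectation of the value of the instance -/

/-- For a `(N, (2k+1)/4)`-cover expanding tuple and `d ≤ N/4` (`N ≥ 2`, `d ≥ k ≥ 1`), the
Grigoriev–Schoenebeck pseudo-density of degree `d` with the parity signs gives the Max-`k`-SAT
instance pseudo-expected value `1`. [cite: Schoenebeck2008, §5 (the `k`-SAT vectors satisfy every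
clause constraint)] -/
theorem cubeExpect_gsDensity_mul_satInstanceK_val (ω : Fin m → ↥(kClauses k n)) (hm : 0 < m)
    {N : ℝ} {d : ℕ} (hexp : IsCoverExpander (fun i => clauseScope (ω i).1) N ((2 * k + 1) / 4))
    (hN : 2 ≤ N) (hd : (d : ℝ) ≤ 1 / 2 * N / 2) (hk1 : 1 ≤ k) (hkd : k ≤ d) :
    cubeExpect (fun x => gsDensity n (tupleVecsK ω) (tupleSatSignsK ω) N d x *
      (satInstanceK ω hm).val x) = 1 := by
  classical
  have hvec := vecExpands_tupleVecsK ω hexp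
  have hc : (0 : ℝ) < 1 / 2 := by norm_num
  have hr0 : (0 : ℝ) ≤ N := by linarith
  have hb : ∀ i, tupleSatSignsK ω i * tupleSatSignsK ω i = 1 := fun i => clauseSign_mul_self _
  set D := gsDensity n (tupleVecsK ω) (tupleSatSignsK ω) N d with hD
  have hval : ∀ x, (satInstanceK ω hm).val x =
      1 - (1 / (m : ℝ)) * ∑ i : Fin m, unsatInd (ω i).1 x := by
    intro x
    unfold CSPInstance.val satInstanceK
    simp only
    have hmr : (m : ℝ) ≠ 0 := by exact_mod_cast hm.ne'
    have hterm : ∀ i : Fin m, (if (satConstraintK (ω i)).sat x then (1 : ℝ) else 0) =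
        1 - unsatInd (ω i).1 x := by
      intro i
      rw [satConstraintK_sat (ω i) x (extAssign x) (fun v h => extAssign_of_lt x h), unsatInd_eq]
      split_ifs <;> norm_num
    rw [Finset.sum_congr rfl fun i _ => hterm i, Finset.sum_sub_distrib, Finset.sum_const,
      Finset.card_univ, Fintype.card_fin, nsmul_eq_mul, mul_one]
    field_simp
  have hfun : (fun x => D x * (satInstanceK ω hm).val x) =
      fun x => D x * (1 - (1 / (m : ℝ)) * ∑ i : Fin m, unsatInd (ω i).1 x) := by
    funext x; rw [hval x]
  rw [hfun, cubeExpect_mul_sub, cubeExpect_mul_const, cubeExpect_gsDensity hvec hc hd hr0,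
    cubeExpect_mul_const_mul, cubeExpect_mul_finset_sum]
  have hzero : ∀ i ∈ (univ : Finset (Fin m)), cubeExpect (fun x => D x * unsatInd (ω i).1 x) = 0 := by
    intro i _
    exact cubeExpect_gsDensity_mul_unsatInd hvec hc hd hN hb (ω i).1
      (fst_lt_of_mem_kClauses (ω i).2) (nodup_map_fst_of_mem_kClauses (ω i).2)
      (by rw [length_of_mem_kClauses (ω i).2]; omega)
      (by rw [length_of_mem_kClauses (ω i).2]; exact hkd) i rfl rfl
  rw [Finset.sum_congr rfl hzero, Finset.sum_const_zero, mul_zero, sub_zero, mul_one]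

/-! ### Schoenebeck's theorem for Max-`k`-SAT -/

/-- **Schoenebeck 2008 (Max-`k`-SAT corollary of the random-`k`-CNF theorem), all `k ≥ 3` —
PROVED.** For every `k ≥ 3` and `ε > 0` there are `c_ε > 0` and `n₀` such that for every
`n ≥ n₀` some Max-`k`-SAT instance `ℑ` on `n` variables has `opt ≤ 1 − 2^{−k} + ε` while no
`c < 1` has a degree-`⌊c_ε n⌋` sum-of-squares certificate of `c − ℑ` on `{0,1}ⁿ` (so the
degree-`⌊c_ε n⌋` Lasserre value is `1`: integrality gap `2^k/(2^k−1) − O(ε)`).  Proof: the good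
tuple of `exists_good_tupleK` and the Grigoriev–Schoenebeck pseudo-density against weak duality,
as in the `k = 3` theorem `Schoenebeck2008_maxThreeSatSos_holds`.
[cite: Schoenebeck2008, §5 (Max-`k`-SAT corollary; restated in Tulsiani2009, §1 p. 2)] -/
theorem Schoenebeck2008_maxKSatSos (hk : 3 ≤ k) :
    ∀ ε : ℝ, 0 < ε → ∃ cε : ℝ, 0 < cε ∧ ∃ n₀ : ℕ, ∀ n : ℕ, n₀ ≤ n →
      ∃ I : CSPInstance k n (maxKSatPreds k), I.OptLE (1 - 1 / 2 ^ k + ε) ∧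
        ∀ c : ℝ, c < 1 → ¬ HasSosCertificate ⌊cε * n⌋₊ (fun x => c - I.val x) := by
  intro ε hε
  classical
  set ε' : ℝ := min ε 1 with hε'
  have hε'0 : 0 < ε' := lt_min hε one_pos
  have hε'1 : ε' ≤ 1 := min_le_right _ _
  have hε'ε : ε' ≤ ε := min_le_left _ _
  obtain ⟨Δ, hΔ, κ, hκ, n₀, H⟩ := exists_good_tupleK hk hε'0 hε'1
  refine ⟨κ / 32, by positivity, max n₀ ⌈(32 * k + 128) / κ⌉₊, fun n hn => ?_⟩
  have hn₀ : n₀ ≤ n := le_of_max_le_left hn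
  have hκn : 32 * k + 128 ≤ κ * n := by
    have h1 : (⌈(32 * k + 128) / κ⌉₊ : ℝ) ≤ n := by exact_mod_cast le_of_max_le_right hn
    have h2 : (32 * k + 128) / κ ≤ n := (Nat.le_ceil _).trans h1
    rw [div_le_iff₀ hκ] at h2
    linarith
  have hk0 : (0 : ℝ) ≤ k := by positivity
  obtain ⟨hN2, hd2, hdN⟩ := degree_bookkeeping hκ (by linarith)
  obtain ⟨ω, hexp, hsat⟩ := H n hn₀
  have hn1 : 1 ≤ n := by
    by_contra h; push Not at h
    have : n = 0 := by omega
    rw [this] at hκn; simp at hκn; linarith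
  have hm : 0 < Δ * n := Nat.mul_pos (by omega) (by omega)
  set d : ℕ := ⌊κ / 32 * n⌋₊ with hddef
  have hkd : k ≤ d := by
    refine Nat.le_floor ?_
    have : (k : ℝ) ≤ κ / 32 * n := by linarith
    exact this
  have hdle : (d : ℝ) ≤ 1 / 2 * ((⌊κ * n⌋₊ : ℕ) : ℝ) / 2 := by
    have : (d : ℝ) ≤ ((2 * d : ℕ) : ℝ) := by push_cast; linarith
    exact this.trans hdN
  refine ⟨satInstanceK ω hm, fun x => ?_, fun c hc hsos => ?_⟩
  · -- soundness: `opt ≤ 1 − 2^{−k} + ε`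
    rw [satInstanceK_val ω hm x (extAssign x) (fun v h => extAssign_of_lt x h)]
    rw [div_le_iff₀ (by exact_mod_cast hm)]
    calc _ ≤ (1 - 1 / 2 ^ k + ε') * (Δ * n : ℕ) := hsat x
      _ ≤ (1 - 1 / 2 ^ k + ε) * (Δ * n : ℕ) := by push_cast; gcongr
      _ = (1 - 1 / 2 ^ k + ε) * ((Δ * n : ℕ) : ℝ) := by push_cast; ring
  · -- completeness for the pseudo-density: no certificate below `1`
    have hvec := vecExpands_tupleVecsK ω hexp
    have hb : ∀ i, tupleSatSignsK ω i * tupleSatSignsK ω i = 1 := fun i => clauseSign_mul_self _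
    have hD := isPseudoDensity_gsDensity (n := n) (b := tupleSatSignsK ω) hvec (by norm_num) hdle
      (by linarith) hb
    have h0 := hD.cubeExpect_mul_nonneg hsos
    rw [cubeExpect_mul_sub, cubeExpect_mul_const, hD.1,
      cubeExpect_gsDensity_mul_satInstanceK_val ω hm hexp hN2 hdle (by omega) hkd] at h0
    linarith

/-- **Schoenebeck's theorem in `(c,s)`-approximation currency:** for `k ≥ 3` and `ε > 0` there are
`c_ε > 0`, `n₀` such that for all `n ≥ n₀`, every `d ≤ ⌊c_ε n⌋` and every `c < 1`, the degree-`d`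
sum-of-squares relaxation (squares of functions of degree `≤ d/2`) fails to achieve a
`(c, 1 − 2^{−k} + ε)`-approximation of Max-`k`-SAT on `n` variables.
[cite: Schoenebeck2008, §5 (Max-`k`-SAT corollary)] [cite: LeeRaghavendraSteurer2015, Thm 6.5 (the `k = 3` form)] -/
theorem Schoenebeck2008_maxKSatSos_not_achievesApprox (hk : 3 ≤ k) {ε : ℝ} (hε : 0 < ε) :
    ∃ cε : ℝ, 0 < cε ∧ ∃ n₀ : ℕ, ∀ n : ℕ, n₀ ≤ n → ∀ d : ℕ, d ≤ ⌊cε * n⌋₊ →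
      ∀ c : ℝ, c < 1 →
        ¬ AchievesApprox (maxKSatPreds k) (degreeLE n (d / 2)) c (1 - 1 / 2 ^ k + ε) := by
  obtain ⟨cε, hcε, n₀, H⟩ := Schoenebeck2008_maxKSatSos hk ε hε
  refine ⟨cε, hcε, n₀, fun n hn d hd c hc hA => ?_⟩
  obtain ⟨I, hI, hnot⟩ := H n hn
  have h1 : SubspaceSos (degreeLE n (d / 2)) I.val c := hA I hI
  rw [subspaceSos_degreeLE_iff] at h1
  exact hnot c hc (h1.of_degree_le hd)

/-! ### Polynomial-size SDP relaxations do not beat `1 − 2^{−k}` on Max-`k`-SAT (LRS Thm 1.6) -/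

/-- `(log n)^{C+1} ≤ a·n` for `n` large. [folklore] -/
private theorem eventually_pow_log_le_mul' (C : ℕ) {a : ℝ} (ha : 0 < a) :
    ∃ n₀ : ℕ, ∀ n : ℕ, n₀ ≤ n → Real.log n ^ (C + 1) ≤ a * n := by
  have hev : ∀ᶠ x : ℝ in atTop, Real.log x ^ (C + 1) ≤ a * x := by
    have hb := (Real.isLittleO_pow_log_id_atTop (n := C + 1)).bound ha
    filter_upwards [hb, eventually_ge_atTop (0 : ℝ)] with x hx hx0
    rw [id, Real.norm_eq_abs, Real.norm_eq_abs, abs_of_nonneg hx0] at hx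
    exact (le_abs_self _).trans hx
  obtain ⟨n₀, hn₀⟩ := eventually_atTop.1 (tendsto_natCast_atTop_atTop.eventually hev)
  exact ⟨n₀, hn₀⟩

/-- **Lee–Raghavendra–Steurer 2015, Thm 1.6 ⇒ polynomial-size SDP lower bound from a linear-degree
sum-of-squares gap, for an arbitrary Boolean Max-CSP — PROVED.** If for every `ε > 0` the degree-`d`
relaxations, `d ≤ ⌊c_ε n⌋`, `n ≥ n₀(ε)`, fail to `(c, s₀ + ε)`-approximate Max-`𝒫_n` for all `c < 1`
(the shape of LRS Thm 6.5), then for all `s > s₀`, `c < 1`, `C ∈ ℕ` and all large `n`, no subspace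
`U` of functions on `{0,1}ⁿ` with `dim U ≤ n^C` achieves a `(c,s)`-approximation of Max-`𝒫_n`
(Thm 1.6 = the tree's theorem `LeeRaghavendraSteurer2015_thm16_holds` at `d = 4C + 4` on `{0,1}^m`,
`m` large; then `n^C ≤ α (n/log n)^{C+1}` eventually).
[cite: LeeRaghavendraSteurer2015, Thm 1.6 and the paragraph following it (p. 6)] -/
theorem LeeRaghavendraSteurer2015_poly_of_linearSosGap (P : Set ((Fin k → Bool) → Bool)) {s₀ : ℝ}
    (hgap : ∀ ε : ℝ, 0 < ε → ∃ cε : ℝ, 0 < cε ∧ ∃ n₀ : ℕ, ∀ n : ℕ, n₀ ≤ n →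
      ∀ d : ℕ, d ≤ ⌊cε * n⌋₊ → ∀ c : ℝ, c < 1 →
        ¬ AchievesApprox P (degreeLE n (d / 2)) c (s₀ + ε)) :
    ∀ s : ℝ, s₀ < s → ∀ c : ℝ, c < 1 → ∀ C : ℕ, ∃ n₀ : ℕ, ∀ n : ℕ, n₀ ≤ n →
      ∀ U : Submodule ℝ ((Fin n → Bool) → ℝ), (Module.finrank ℝ U : ℝ) ≤ (n : ℝ) ^ C →
        ¬ AchievesApprox P (U : Set ((Fin n → Bool) → ℝ)) c s := by
  intro s hs c hc C
  obtain ⟨cε, hcε, n₁, H⟩ := hgap (s - s₀) (by linarith)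
  set d : ℕ := 4 * C + 4 with hd
  set m : ℕ := max n₁ ⌈((2 * d : ℕ) : ℝ) / cε⌉₊ with hm
  have hm₁ : n₁ ≤ m := le_max_left _ _
  have h2d : 2 * d ≤ ⌊cε * m⌋₊ := by
    apply Nat.le_floor
    have h1 : ((2 * d : ℕ) : ℝ) / cε ≤ m :=
      (Nat.le_ceil _).trans (by rw [hm]; exact_mod_cast le_max_right _ _)
    rw [div_le_iff₀ hcε] at h1
    linarith
  have hfail : ¬ AchievesApprox P (degreeLE m d) c s := by
    have h1 := H m hm₁ (2 * d) h2d c hc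
    rwa [show s₀ + (s - s₀) = s by ring, Nat.mul_div_cancel_left d two_pos] at h1
  obtain ⟨α, hα, n₂, H16⟩ := LeeRaghavendraSteurer2015_thm16_holds k P c s m d hfail
  obtain ⟨n₃, hn₃⟩ := eventually_pow_log_le_mul' C hα
  refine ⟨max (max n₂ n₃) 2, fun n hn U hU => H16 n ?_ U ?_⟩
  · exact le_trans (le_max_left _ _) (le_trans (le_max_left _ _) hn)
  have hn2 : (2 : ℝ) ≤ n := by exact_mod_cast le_trans (le_max_right _ _) hn
  have hn0 : (0 : ℝ) < n := by linarith
  have hlog : 0 < Real.log n := Real.log_pos (by linarith)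
  have hlogle : Real.log n ^ (C + 1) ≤ α * n :=
    hn₃ n (le_trans (le_max_right _ _) (le_trans (le_max_left _ _) hn))
  have hexp : ((d : ℝ) / 4) = ((C + 1 : ℕ) : ℝ) := by
    rw [hd]; push_cast; ring
  rw [hexp, Real.rpow_natCast, div_pow]
  calc (Module.finrank ℝ U : ℝ) ≤ (n : ℝ) ^ C := hU
    _ = (n : ℝ) ^ (C + 1) * Real.log n ^ (C + 1) / Real.log n ^ (C + 1) / n := by
        field_simp
        ring
    _ ≤ (n : ℝ) ^ (C + 1) * (α * n) / Real.log n ^ (C + 1) / n := by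
        gcongr
    _ = α * ((n : ℝ) ^ (C + 1) / Real.log n ^ (C + 1)) := by
        field_simp

/-- **Lee–Raghavendra–Steurer 2015 × Schoenebeck 2008: polynomial-size SDP relaxations of
Max-`k`-SAT cannot achieve an approximation better than `1 − 2^{−k}`, for every `k ≥ 3` —
PROVED.** For all `s > 1 − 2^{−k}`, `c < 1` and `C ∈ ℕ` there is `n₀` such that for every
`n ≥ n₀`, no subspace `U` of functions `{0,1}ⁿ → ℝ` with `dim U ≤ n^C` achieves a
`(c,s)`-approximation of Max-`k`-SAT on `n` variables (LRS Thm 1.6, the tree's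
`LeeRaghavendraSteurer2015_thm16_holds`, fed with `Schoenebeck2008_maxKSatSos_not_achievesApprox`
at `d = 4C + 4` on `{0,1}^m`, `m` large; then `n^C ≤ α (n/log n)^{C+1}` eventually).
[cite: LeeRaghavendraSteurer2015, Thm 1.6 and the paragraph following it (p. 6)]
[cite: Schoenebeck2008, §5 (Max-`k`-SAT corollary)] -/
theorem LeeRaghavendraSteurer2015_maxKSat_poly (hk : 3 ≤ k) :
    ∀ s : ℝ, 1 - 1 / 2 ^ k < s → ∀ c : ℝ, c < 1 → ∀ C : ℕ, ∃ n₀ : ℕ, ∀ n : ℕ, n₀ ≤ n →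
      ∀ U : Submodule ℝ ((Fin n → Bool) → ℝ), (Module.finrank ℝ U : ℝ) ≤ (n : ℝ) ^ C →
        ¬ AchievesApprox (maxKSatPreds k) (U : Set ((Fin n → Bool) → ℝ)) c s :=
  LeeRaghavendraSteurer2015_poly_of_linearSosGap (maxKSatPreds k)
    fun _ hε => Schoenebeck2008_maxKSatSos_not_achievesApprox hk hε

/-! ### Quasi-polynomial SDP lower bounds from a linear-degree sum-of-squares gap (LRS Thm 1.5's proof, any predicate set) -/

/-- **The proof of Lee–Raghavendra–Steurer 2015, Thm 1.5, for an arbitrary Boolean Max-CSP —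
PROVED.** Let `k ≥ 3`, `𝒫` a set of `k`-ary predicates and `s₀ ≥ 0` a threshold such that
linear-degree sum-of-squares has a `(c, s₀ + ε)`-gap for every `ε > 0` and `c < 1` (for all
`n ≥ n₀(ε)` and `d ≤ ⌊c_ε n⌋`, the degree-`d` relaxation `degreeLE n (d/2)` does not achieve a
`(c, s₀ + ε)`-approximation of Max-`𝒫` on `n` variables — the shape of LRS Thm 6.5).  Then there
is `α > 0` (here `1/32768`) such that for all `s₀ < s < c < 1` and all large `n`, no subspace `U`
of functions on `{0,1}ⁿ` of dimension `≤ n^{α log n / log log n}` achieves a `(c,s)`-approximation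
of Max-`𝒫_n`.  Proof verbatim as printed for Max 3-Sat (p. 26–27; the tree's
`LeeRaghavendraSteurer2015_thm15_approx_of_thm64_repaired`): degree function `d(m) = ⌊c' m⌋`,
`c' = min(c_ε, 1)`; the corrected Thm 6.4 (`LeeRaghavendraSteurer2015_thm64_repaired_holds`, now
a theorem of the tree) bounds the psd rank of `M^{n,𝒫}_{c,s}` below by `K m^{d(m)²/8}` for
`n > m^{4d(m)}`, `d(m) ≥ k + 1`; `m = ⌊log n/(8 c' log log n)⌋` (`thm15_core_eventually`); and
Prop. 1.13 (`AchievesApprox.hasPsdFactorization`).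
[cite: LeeRaghavendraSteurer2015, Thm 1.5 (p. 6), its proof after Thm 6.5 (p. 26–27), Thm 6.4] -/
theorem LeeRaghavendraSteurer2015_quasipoly_of_linearSosGap (hk : 3 ≤ k)
    (P : Set ((Fin k → Bool) → Bool)) {s₀ : ℝ} (hs₀ : 0 ≤ s₀)
    (hgap : ∀ ε : ℝ, 0 < ε → ∃ cε : ℝ, 0 < cε ∧ ∃ n₀ : ℕ, ∀ n : ℕ, n₀ ≤ n →
      ∀ d : ℕ, d ≤ ⌊cε * n⌋₊ → ∀ c : ℝ, c < 1 →
        ¬ AchievesApprox P (degreeLE n (d / 2)) c (s₀ + ε)) :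
    ∃ α : ℝ, 0 < α ∧ ∀ s : ℝ, s₀ < s → ∀ c : ℝ, s < c → c < 1 →
      ∃ n₀ : ℕ, ∀ n : ℕ, n₀ ≤ n → ∀ U : Submodule ℝ ((Fin n → Bool) → ℝ),
        (Module.finrank ℝ U : ℝ) ≤ (n : ℝ) ^ (α * Real.log n / Real.log (Real.log n)) →
        ¬ AchievesApprox P (U : Set ((Fin n → Bool) → ℝ)) c s := by
  refine ⟨1 / 32768, by norm_num, fun s hs c hsc hc1 => ?_⟩
  obtain ⟨cε, hcε, n₁, Hgap⟩ := hgap (s - s₀) (by linarith)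
  -- the degree function `d(m) = ⌊c' m⌋`, `c' = min(c_ε, 1)`
  set c' : ℝ := min cε 1 with hc'def
  have hc'0 : 0 < c' := lt_min hcε one_pos
  have hc'1 : c' ≤ 1 := min_le_right _ _
  have hc'ε : c' ≤ cε := min_le_left _ _
  set d : ℕ → ℕ := fun m => ⌊c' * m⌋₊ with hddef
  have hdmono : Monotone d := fun a b hab =>
    Nat.floor_le_floor (mul_le_mul_of_nonneg_left (Nat.cast_le.2 hab) hc'0.le)
  have hdtend : Tendsto d atTop atTop :=
    tendsto_nat_floor_atTop.comp (Tendsto.const_mul_atTop hc'0 tendsto_natCast_atTop_atTop)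
  -- the corrected Thm 6.4 at `(ε', s, c)`, `ε' = (1 - c)/2`
  set ε' : ℝ := (1 - c) / 2 with hε'def
  have hε' : 0 < ε' := by rw [hε'def]; linarith
  have hcε' : c + ε' < 1 := by rw [hε'def]; linarith
  obtain ⟨K, hK, H64⟩ := LeeRaghavendraSteurer2015_thm64_repaired_holds k P d hdmono hdtend ε' s c
    hε' (by linarith) hsc hc1.le
  -- the arithmetic, transported to `L = log n`; threshold `T ≥ (k+1)/c' ≥ 4/c'`
  set T : ℝ := max (((k : ℝ) + 1) / c') (n₁ : ℝ) with hTdef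
  have hk4 : (4 : ℝ) ≤ (k : ℝ) + 1 := by
    have : (3 : ℝ) ≤ k := by exact_mod_cast hk
    linarith
  have hT : 4 / c' ≤ T := le_trans (div_le_div_of_nonneg_right hk4 hc'0.le) (le_max_left _ _)
  have hTk : ((k : ℝ) + 1) / c' ≤ T := le_max_left _ _
  obtain ⟨N₀, hN₀⟩ := eventually_atTop.1
    ((Real.tendsto_log_atTop.comp tendsto_natCast_atTop_atTop).eventually
      (thm15_core_eventually K hc'0 hc'1 hT))
  refine ⟨N₀, fun N hN U hU hA => ?_⟩
  obtain ⟨hL0, hLL0, hxδ⟩ := hN₀ N hN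
  simp only [Function.comp_apply] at hL0 hLL0 hxδ
  have hN0 : (0 : ℝ) < N := by
    rcases Nat.eq_zero_or_pos N with h | h
    · simp [h] at hL0
    · exact_mod_cast h
  set L : ℝ := Real.log N with hLdef
  -- `m = ⌊L / (8 c' log L)⌋` and `d(m)`
  set m : ℕ := ⌊L / (8 * c' * Real.log L)⌋₊ with hmdef
  have hA0 : 0 ≤ L / (8 * c' * Real.log L) := by positivity
  have hx1 : L / (8 * c' * Real.log L) - 1 ≤ (m : ℝ) := (Nat.sub_one_lt_floor _).le
  have hx2 : (m : ℝ) ≤ L / (8 * c' * Real.log L) := Nat.floor_le hA0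
  have hcm0 : 0 ≤ c' * m := by positivity
  have hδ1 : c' * m - 1 ≤ ((d m : ℕ) : ℝ) := (Nat.sub_one_lt_floor _).le
  have hδ2 : ((d m : ℕ) : ℝ) ≤ c' * m := Nat.floor_le hcm0
  obtain ⟨hTx, hb, hc⟩ := hxδ m (d m) hx1 hx2 hδ1 hδ2
  -- thresholds: `m ≥ n₁`, `m ≥ 1`, `k + 1 ≤ d(m) ≤ m`, `d(m) ≤ ⌊c_ε m⌋`
  have hn₁ : n₁ ≤ m := by
    have h : (n₁ : ℝ) ≤ m := (le_max_right _ _).trans hTx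
    exact_mod_cast h
  have hcmk : (k : ℝ) + 1 ≤ c' * m := by
    have h := mul_le_mul_of_nonneg_left (hTk.trans hTx) hc'0.le
    rwa [show c' * (((k : ℝ) + 1) / c') = (k : ℝ) + 1 by field_simp] at h
  have hm1 : 1 ≤ m := by
    have h : (1 : ℝ) ≤ m := by
      have := mul_le_mul_of_nonneg_right hc'1 (Nat.cast_nonneg m)
      linarith
    exact_mod_cast h
  have hdk : 2 * ((k + 1) / 2) ≤ d m := by
    have h1 : k + 1 ≤ d m := Nat.le_floor (by exact_mod_cast hcmk)
    have h2 : 2 * ((k + 1) / 2) ≤ k + 1 := Nat.mul_div_le (k + 1) 2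
    omega
  have hdm : d m ≤ m := by
    have h := Nat.floor_le_floor (show c' * m ≤ (m : ℝ) by nlinarith)
    simpa using h
  have hdε : d m ≤ ⌊cε * m⌋₊ :=
    Nat.floor_le_floor (mul_le_mul_of_nonneg_right hc'ε (Nat.cast_nonneg m))
  -- failure of the degree-`d(m)` relaxation at `(c + ε', s)` on `m` variables
  have hfail : ¬ AchievesApprox P (degreeLE m (d m / 2)) (c + ε') s := by
    have h := Hgap m hn₁ (d m) hdε (c + ε') hcε'
    rwa [show s₀ + (s - s₀) = s by ring] at h
  -- `m^{4 d(m)} < N`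
  have hx0 : (0 : ℝ) < m := by exact_mod_cast hm1
  have hC3 : (m : ℝ) ^ (4 * d m) < N := by
    have h1 : (m : ℝ) ^ (4 * d m) = Real.exp (4 * (d m : ℝ) * Real.log m) := by
      rw [← Real.rpow_natCast, Real.rpow_def_of_pos hx0]
      congr 1
      push_cast
      ring
    rw [h1]
    calc Real.exp (4 * (d m : ℝ) * Real.log m) < Real.exp L := Real.exp_lt_exp.2 hb
      _ = N := by rw [hLdef, Real.exp_log hN0]
  -- `dim U ≤ N^{α log N / log log N} ≤ K m^{d(m)²/8}`
  have hC4 : (Module.finrank ℝ U : ℝ) ≤ K * (m : ℝ) ^ (((d m : ℕ) : ℝ) ^ 2 / 8) := by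
    refine hU.trans ?_
    rw [Real.rpow_def_of_pos hN0, Real.rpow_def_of_pos hx0, ← hLdef]
    calc Real.exp (L * (1 / 32768 * L / Real.log L))
        = Real.exp (L ^ 2 / (32768 * Real.log L)) := by
          congr 1
          field_simp
      _ ≤ Real.exp (Real.log K + ((d m : ℕ) : ℝ) ^ 2 / 8 * Real.log m) := Real.exp_le_exp.2 hc
      _ = K * Real.exp (Real.log m * (((d m : ℕ) : ℝ) ^ 2 / 8)) := by
          rw [Real.exp_add, Real.exp_log hK, mul_comm (Real.log (m : ℝ))]
  exact H64 m hm1 hdk hdm hfail N hC3 (Module.finrank ℝ U) hC4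
    (AchievesApprox.hasPsdFactorization U hA)

/-- **Lee–Raghavendra–Steurer 2015 Thm 1.5 for Max-`k`-SAT, every `k ≥ 3` — PROVED:** there is
`α > 0` such that for all `1 − 2^{−k} < s < c < 1` and all large `n`, no SDP relaxation of
Max-`k`-SAT of size `≤ n^{α log n / log log n}` (no subspace `U` of that dimension) achieves a
`(c,s)`-approximation.  From `LeeRaghavendraSteurer2015_quasipoly_of_linearSosGap` and
Schoenebeck's theorem `Schoenebeck2008_maxKSatSos_not_achievesApprox`.
[cite: LeeRaghavendraSteurer2015, Thm 1.5 and Thm 1.6 (p. 6)] [cite: Schoenebeck2008, §5 (Max-`k`-SAT corollary)] -/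
theorem LeeRaghavendraSteurer2015_maxKSat_quasipoly (hk : 3 ≤ k) :
    ∃ α : ℝ, 0 < α ∧ ∀ s : ℝ, 1 - 1 / 2 ^ k < s → ∀ c : ℝ, s < c → c < 1 →
      ∃ n₀ : ℕ, ∀ n : ℕ, n₀ ≤ n → ∀ U : Submodule ℝ ((Fin n → Bool) → ℝ),
        (Module.finrank ℝ U : ℝ) ≤ (n : ℝ) ^ (α * Real.log n / Real.log (Real.log n)) →
        ¬ AchievesApprox (maxKSatPreds k) (U : Set ((Fin n → Bool) → ℝ)) c s := by
  have hs₀ : (0 : ℝ) ≤ 1 - 1 / 2 ^ k := by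
    rw [sub_nonneg, div_le_one (by positivity)]; exact one_le_pow₀ (by norm_num)
  exact LeeRaghavendraSteurer2015_quasipoly_of_linearSosGap hk (maxKSatPreds k) hs₀
    fun ε hε => Schoenebeck2008_maxKSatSos_not_achievesApprox hk hε

end Literature.Combinatorics.Optimization

end
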